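import Literature.Algebra.EuclideanLattices.MRLemma510Function
import Literature.Algebra.EuclideanLattices.IntegerMatrixInverseMachine
import Literature.Computability.Complexity.CodeFPLists
import Literature.Computability.Complexity.CodeFPFinite
import HarnessLib

/-!
# Micciancio–Regev 2007, Lemma 5.10 (`GIVP ← IncGDD`): the loop is typed polynomial time

Topic `Algebra/EuclideanLattices` (family `pqc`). Third of three files realising MR07's Lemma 5.10
(authors' version p. 24: "there exists a reduction from `GIVP^φ_{8γ}` to `IncGDD^φ_{γ,8}` … this procedure
terminates after a polynomial number of steps") at machine level, the loop behind Cor. 5.13 as invoked in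
the first step of the proof of Thm. 5.23 (p. 29). `MRLemma510Function.lean` writes the loop as total
functions on lists of integers (`roundUpdate`, `loopRun`, `loopOut`); this file proves them computable in
polynomial time in the typed sense of `CodeFP.lean`, for an oracle answer function `sol` itself computed
on codes (`hsol : CodeFP (pairE strE strE) strE (uncurry sol)`, e.g. the `run` of a PPT `RandAlg`), by
assembling the existing typed leaves (`CodeFP*`, `AOWListMatrixFP`, Cohen's integral inverse column
`IntegerMatrixInverseMachine.invCol_codeFP`); no machine, transducer or tape is written:

* the list arithmetic (`sqNormZ`, `smulZ`, `subZ`, `vecMulZ`, `argmaxZ`) and the data of a round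
  (`roundIdx`, `roundA`, `roundDir`, `roundL`, `roundUt`, `roundTw`, `roundTd`, `roundRn`) on codes;
* `ctxE` (the code of a context `(n, U, k₀, P)`), `roundInst₀_encode_codeFP`, `roundInst_encode_codeFP`
  (the padded oracle instance);
* `readVec_codeFP` — the TOTAL answer reader (every string is read, by a fold of the brick algebra over
  its items, each canonicalised by `zcanonF`), `verify_codeFP`, `firstAccepted_codeFP`,
  `roundUpdate_codeFP`;
* the size invariant the fold needs on EVERY input (`StateOK`: rows of `U` or accepted rows, whose
  squared norm the acceptance test clamps by `‖U‖²`): `length_state_le_of_stateOK`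
  (`|code state| ≤ 86|ctxE c|³ + 4`), and `exists_poly_length_roundInst₀` (the unpadded instances met
  along a run are polynomially short in `|⟨1ⁿ, U⟩|`, so the padding length can be a polynomial of the
  input);
* `blocksOf_codeFP` (two nested `strChunks`) and **`loopOut_codeFP`** — the run `((c, (K, T)), r) ↦
  loopOut c sol K T r` is typed polynomial time (`CodeFP.foldl` with the bound above).

All proved; no named fact.

## References

* D. Micciancio, O. Regev, *Worst-case to average-case reductions based on Gaussian measures*,
  SIAM J. Comput. 37 (2007) 267–302; authors' version, Lemma 5.10 and its proof (p. 24), Cor. 5.13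
  (p. 25: "probabilistic polynomial time reduction").
* S. Arora, B. Barak, *Computational Complexity: A Modern Approach*, CUP 2009, §1.3 (polynomial time is
  closed under composition and polynomially bounded loops) [AroraBarak2009].
* H. Cohen, *A Course in Computational Algebraic Number Theory*, GTM 138, 1993, §2.6.3 [Cohen1993].
-/

noncomputable section

namespace Literature.Algebra.EuclideanLattices

namespace MRLemma510

open Literature.Computability.Complexity Literature.Computability.Complexity.CodeFP
  Literature.Computability.Complexity.Brick Literature.Computability.Complexity.LMat GSInverse Polynomial
  Literature.Computability.QuantumComplexity

/-! ### The list arithmetic on codes -/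

/-- `sqNormZ` on codes. [cite: AroraBarak2009, §1.3] -/
theorem sqNormZ_codeFP : CodeFP (rawE intE) intE sqNormZ :=
  (dotZ_codeFP.comp ((CodeFP.id _).pair (CodeFP.id _))).congr fun _ => rfl

/-- `sqNorms` on codes. [cite: AroraBarak2009, §1.3] -/
theorem sqNorms_codeFP : CodeFP matE (rawE intE) sqNorms := (CodeFP.map₀ sqNormZ_codeFP).congr fun _ => rfl

/-- `smulZ` on codes. [cite: AroraBarak2009, §1.3] -/
theorem smulZ_codeFP : CodeFP (pairE intE (rawE intE)) (rawE intE) (fun p => smulZ p.1 p.2) :=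
  (CodeFP.map (σ := ℤ) (g := fun q : ℤ × ℤ => q.1 * q.2) intMul).congr fun _ => rfl

/-- `subZ` on codes: `(1ⁿ, (u, v)) ↦ subZ n u v`. [cite: AroraBarak2009, §1.3] -/
theorem subZ_codeFP : CodeFP (pairE unE (pairE (rawE intE) (rawE intE))) (rawE intE) (fun p => subZ p.1 p.2.1 p.2.2) := by
  -- item `j`, context `(u, v)`
  have hu : CodeFP (pairE (pairE (rawE intE) (rawE intE)) natE) intE (fun q => q.1.1.getD q.2 0) :=
    ((rawGetOr intE).comp ((fst _ _).fst'.pair ((snd _ _).pair (const _ (0 : ℤ)))) :)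
  have hv : CodeFP (pairE (pairE (rawE intE) (rawE intE)) natE) intE (fun q => q.1.2.getD q.2 0) :=
    ((rawGetOr intE).comp ((fst _ _).snd'.pair ((snd _ _).pair (const _ (0 : ℤ)))) :)
  have hg : CodeFP (pairE (pairE (rawE intE) (rawE intE)) natE) intE (fun q => q.1.1.getD q.2 0 - q.1.2.getD q.2 0) :=
    (intSub.comp (hu.pair hv) :)
  exact ((CodeFP.map hg).comp ((snd _ _).pair (urange.comp (fst _ _)))).congr fun p => rfl

/-- `vecMulZ` on codes: `(1ⁿ, (z, U)) ↦ z ᵥ* U`. [cite: AroraBarak2009, §1.3] -/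
theorem vecMulZ_codeFP : CodeFP (pairE unE (pairE (rawE intE) matE)) (rawE intE) (fun p => vecMulZ p.1 p.2.1 p.2.2) := by
  -- the summand, context `((z, U), j)`, index `i`
  have hz : CodeFP (pairE (pairE (pairE (rawE intE) matE) natE) natE) intE (fun q => q.1.1.1.getD q.2 0) :=
    ((rawGetOr intE).comp ((fst _ _).fst'.fst'.pair ((snd _ _).pair (const _ (0 : ℤ)))) :)
  have he : CodeFP (pairE (pairE (pairE (rawE intE) matE) natE) natE) intE (fun q => ent q.1.1.2 q.2 q.1.2) :=
    (entFP.comp ((fst _ _).fst'.snd'.pair ((snd _ _).pair (fst _ _).snd')) :)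
  have hf : CodeFP (pairE (pairE (pairE (rawE intE) matE) natE) natE) intE
      (fun q => q.1.1.1.getD q.2 0 * ent q.1.1.2 q.2 q.1.2) := (intMul.comp (hz.pair he) :)
  -- the entry `j`: `sumRange n`, context `((z, U), j)` with budget `1ⁿ`
  have hsum := sumRangeFP (σ := (List ℤ × List (List ℤ)) × ℕ) hf
  -- item `j` with context `(1ⁿ, (z, U))`
  have hitem : CodeFP (pairE (pairE unE (pairE (rawE intE) matE)) natE) intE
      (fun q => sumRange q.1.1 fun i => q.1.2.1.getD i 0 * ent q.1.2.2 i q.2) :=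
    (hsum.comp ((((fst _ _).snd').pair (snd _ _)).pair (fst _ _).fst')).congr fun q => rfl
  exact ((CodeFP.map hitem).comp ((CodeFP.id _).pair (urange.comp (fst _ _)))).congr fun p => rfl

/-- The accumulator of the `argmaxZ` fold is the start or a scanned index. [folklore] -/
theorem argmaxZ_fold_mem (l : List ℤ) (L : List ℕ) : ∀ (m : List ℕ) (b : ℕ), (b = 0 ∨ b ∈ L) → m ⊆ L →
    (m.foldl (fun best j => if l.getD best 0 < l.getD j 0 then j else best) b = 0 ∨
      m.foldl (fun best j => if l.getD best 0 < l.getD j 0 then j else best) b ∈ L)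
  | [], b, hb, _ => by simpa using hb
  | a :: m, b, hb, hm => by
    rw [List.foldl_cons]
    refine argmaxZ_fold_mem l L m _ ?_ (fun x hx => hm (List.mem_cons_of_mem _ hx))
    split_ifs
    · exact Or.inr (hm (by simp))
    · exact hb

/-- `argmaxZ` on codes: a fold over the indices with the list as context. [cite: AroraBarak2009, §1.3] -/
theorem argmaxZ_codeFP : CodeFP (rawE intE) natE argmaxZ := by
  have hstep : CodeFP (pairE (rawE intE) (pairE natE natE)) natE
      (fun t => if t.1.getD t.2.2 0 < t.1.getD t.2.1 0 then t.2.1 else t.2.2) :=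
    (CodeFP.ite (intLt.comp (((rawGetOr intE).comp ((fst _ _).pair ((snd _ _).snd'.pair (const _ (0 : ℤ))))).pair
      ((rawGetOr intE).comp ((fst _ _).pair ((snd _ _).fst'.pair (const _ (0 : ℤ)))))))
      (snd _ _).fst' (snd _ _).snd').congr fun t => by
        simp only [decide_eq_true_eq]
  have hfold := CodeFP.foldl (σ := List ℤ) (α := ℕ) (β := ℕ) (eσ := rawE intE) (eα := natE) (eβ := natE)
    (step := fun l j best => if l.getD best 0 < l.getD j 0 then j else best) (init := fun _ => 0)
    hstep (const _ 0) X (fun l l₁ l₂ => by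
      rw [eval_X, pairE_apply, length_boolPair]
      rcases argmaxZ_fold_mem l (l₁ ++ l₂) l₁ 0 (Or.inl rfl) (List.subset_append_left _ _) with h | h
      · rw [h]; simp
      · have := length_item_le_length_rawE natE h
        simp only
        omega)
  exact (hfold.comp ((CodeFP.id _).pair (urange.comp (ulength intE)))).congr fun l => rfl

/-! ### The data of a round on codes -/

/-- `roundIdx`. [folklore] -/
theorem roundIdx_codeFP : CodeFP matE natE roundIdx := (argmaxZ_codeFP.comp sqNorms_codeFP).congr fun _ => rfl

/-- `roundA`. [folklore] -/
theorem roundA_codeFP : CodeFP matE intE roundA :=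
  ((rawGetOr intE).comp (sqNorms_codeFP.pair (roundIdx_codeFP.pair (const _ (0 : ℤ))))).congr fun _ => rfl

/-- `roundDir` (Cohen's integral inverse column, `IntegerMatrixInverseMachine.invCol_codeFP`). [cite: Cohen1993, §2.6.3] -/
theorem roundDir_codeFP : CodeFP matE (rawE intE) roundDir :=
  (invCol_codeFP.comp ((CodeFP.id _).pair roundIdx_codeFP)).congr fun _ => rfl

/-- `roundL` in unary (the size of a binary numeral is the length of its code, cf.
`QuantumComplexity.natSizeU_codeFP`). [folklore] -/
theorem roundL_codeFP : CodeFP matE unE roundL := by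
  have hsize : CodeFP natE unE Nat.size := (strLength.comp strOfNat).congr fun m => length_natE m
  exact (unAdd.comp ((const _ 3).pair (hsize.comp (intToNat.comp (sqNormZ_codeFP.comp roundDir_codeFP))))).congr
    fun _ => rfl

/-- `roundUt`. [folklore] -/
theorem roundUt_codeFP : CodeFP matE natE roundUt := by
  have hW : CodeFP matE natE (fun V => (sqNormZ (roundDir V)).toNat) := (intToNat.comp (sqNormZ_codeFP.comp roundDir_codeFP) :)
  have hA : CodeFP matE natE (fun V => (roundA V).toNat) := (intToNat.comp roundA_codeFP :)
  have h4 : CodeFP matE natE (fun V => 4 ^ roundL V) := (natPow.comp ((const _ 4).pair roundL_codeFP) :)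
  have hnum : CodeFP matE natE (fun V => 4 ^ roundL V * (roundA V).toNat) := (natMul.comp (h4.pair hA) :)
  have hden : CodeFP matE natE (fun V => 4 * (sqNormZ (roundDir V)).toNat) := (natMul.comp ((const _ 4).pair hW) :)
  have hq : CodeFP matE natE (fun V => 4 ^ roundL V * (roundA V).toNat / (4 * (sqNormZ (roundDir V)).toNat)) :=
    (natDiv.comp (hnum.pair hden) :)
  have hs : CodeFP matE natE (fun V => Nat.sqrt (4 ^ roundL V * (roundA V).toNat / (4 * (sqNormZ (roundDir V)).toNat))) :=
    (natSqrt.comp hq :)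
  exact ((natAdd.comp (hs.pair (const _ 1)) :) : CodeFP matE natE fun V =>
    Nat.sqrt (4 ^ roundL V * (roundA V).toNat / (4 * (sqNormZ (roundDir V)).toNat)) + 1)

/-- `roundTw`. [folklore] -/
theorem roundTw_codeFP : CodeFP matE (rawE intE) roundTw :=
  (smulZ_codeFP.comp ((intOfNat.comp roundUt_codeFP).pair roundDir_codeFP)).congr fun _ => rfl

/-- `roundTd`. [folklore] -/
theorem roundTd_codeFP : CodeFP matE natE roundTd := (natPow.comp ((const _ 2).pair roundL_codeFP)).congr fun _ => rfl

/-- `roundRn`. [folklore] -/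
theorem roundRn_codeFP : CodeFP matE natE roundRn := (natSqrt.comp (intToNat.comp roundA_codeFP)).congr fun _ => rfl

/-! ### The context and the instances of a round on codes -/

/-- The tuple of a context. [folklore] -/
def ctxTup (c : Ctx) : (ℕ × List (List ℤ)) × (ℕ × ℕ) := ((c.n, c.U), (c.k₀, c.P))

/-- The code of the tuple of a context: `⟨⟨1ⁿ, U⟩, ⟨1^{k₀}, 1^{P}⟩⟩`. [folklore] -/
abbrev ctxTupE : (ℕ × List (List ℤ)) × (ℕ × ℕ) → List Bool := pairE (pairE unE matE) (pairE unE unE)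

/-- The code of a context. [folklore] -/
def ctxE : Ctx → List Bool := fun c => ctxTupE (ctxTup c)

/-- Reading the tuple of a context. [folklore] -/
theorem ctxTup_codeFP : CodeFP ctxE ctxTupE ctxTup := transparent fun _ => rfl

/-- Reading the fields of a context. [folklore] -/
theorem ctx_n_codeFP : CodeFP ctxE unE Ctx.n := (ctxTup_codeFP.fst'.fst' :)

/-- Reading the fields of a context. [folklore] -/
theorem ctx_U_codeFP : CodeFP ctxE matE Ctx.U := (ctxTup_codeFP.fst'.snd' :)

/-- Reading the fields of a context. [folklore] -/
theorem ctx_k₀_codeFP : CodeFP ctxE unE Ctx.k₀ := (ctxTup_codeFP.snd'.fst' :)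

/-- Reading the fields of a context. [folklore] -/
theorem ctx_P_codeFP : CodeFP ctxE unE Ctx.P := (ctxTup_codeFP.snd'.snd' :)

/-- **The unpadded instance code of a round.** [folklore] -/
theorem roundInst₀_encode_codeFP : CodeFP (pairE ctxE matE) strE (fun p => (roundInst₀ p.1 p.2).encode) := by
  have hn : CodeFP (pairE ctxE matE) unE (fun p => p.1.n) := (ctx_n_codeFP.comp (fst _ _) :)
  have hU : CodeFP (pairE ctxE matE) matE (fun p => p.1.U) := (ctx_U_codeFP.comp (fst _ _) :)
  have hV : CodeFP (pairE ctxE matE) matE (fun p => p.2) := snd _ _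
  have h : CodeFP (pairE ctxE matE) IncGDDInst.tupleE (fun p => (roundInst₀ p.1 p.2).tuple) :=
    ((hn.pair hU).pair (hV.pair (((roundTw_codeFP.comp hV).pair (roundTd_codeFP.comp hV)).pair
      (((roundRn_codeFP.comp hV).pair (const _ 8)).pair (const _ ([] : List Bool)))))).congr fun p => rfl
  exact h.recodeOut fun p => rfl

/-- **The padded instance code of a round.** [folklore] -/
theorem roundInst_encode_codeFP : CodeFP (pairE ctxE matE) strE (fun p => (roundInst p.1 p.2).encode) := by
  have hn : CodeFP (pairE ctxE matE) unE (fun p => p.1.n) := (ctx_n_codeFP.comp (fst _ _) :)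
  have hU : CodeFP (pairE ctxE matE) matE (fun p => p.1.U) := (ctx_U_codeFP.comp (fst _ _) :)
  have hV : CodeFP (pairE ctxE matE) matE (fun p => p.2) := snd _ _
  have hP : CodeFP (pairE ctxE matE) unE (fun p => p.1.P) := (ctx_P_codeFP.comp (fst _ _) :)
  have hsub : CodeFP (pairE ctxE matE) unE (fun p => p.1.P - (roundInst₀ p.1 p.2).encode.length) :=
    (unOfNatMin.comp (hP.pair (natSub.comp ((natOfUn.comp hP).pair (strNatLength.comp roundInst₀_encode_codeFP))))).congr
      fun p => by simp only [id]; omega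
  have hpad : CodeFP (pairE ctxE matE) strE (fun p => unE (p.1.P - (roundInst₀ p.1 p.2).encode.length)) :=
    strOfUn.comp hsub
  have h : CodeFP (pairE ctxE matE) IncGDDInst.tupleE (fun p => (roundInst p.1 p.2).tuple) :=
    ((hn.pair hU).pair (hV.pair (((roundTw_codeFP.comp hV).pair (roundTd_codeFP.comp hV)).pair
      (((roundRn_codeFP.comp hV).pair (const _ 8)).pair hpad)))).congr fun p => rfl
  exact h.recodeOut fun p => rfl

/-! ### Reading answers on codes -/

/-- The step of the reader's fold: `⟨w, ⟨item, acc⟩⟩ ↦ acc ++ ⟨canonical item⟩`. [folklore] -/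
noncomputable def readStep : List Bool → List Bool :=
  fun z => (sndF ∘ sndF) z ++ fanoutFn (zcanonF ∘ fstF ∘ sndF) (fun _ => []) z

/-- `readStep ∈ FP`. [folklore] -/
theorem readStep_mem_FP : readStep ∈ FP :=
  append_mem_FP (comp_mem_FP sndF_mem_FP sndF_mem_FP)
    (fanoutFn_mem_FP (comp_mem_FP zcanonF_mem_FP (comp_mem_FP fstF_mem_FP sndF_mem_FP)) (const_mem_FP _))

/-- The value of the step. [folklore] -/
theorem readStep_apply (w a acc : List Bool) :
    readStep (boolPair w (boolPair a acc)) = acc ++ boolPair (dpEnc (ival a)) [] := by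
  simp [readStep]

/-- Growth of the step: `|canonical item| ≤ 2|item| + 2`. [folklore] -/
theorem foldGrowth_readStep : FoldGrowth 6 readStep := by
  intro v
  have h1 : (dpEnc (ival (fstF (sndF v)))).length ≤ 2 * (fstF (sndF v)).length + 2 :=
    (length_dpEnc_le_two_mul _).trans (by
      have := length_encodeNat_natAbs_ival_le (fstF (sndF v))
      have := zlen_le_length (fstF (sndF v))
      omega)
  simp only [readStep, Function.comp_apply, fanoutFn_apply, zcanonF_eq, List.length_append, length_boolPair,
    List.length_nil]
  omega

/-- The reader as a string function: fold the step over the items of the input. [folklore] -/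
noncomputable def readVecF : List Bool → List Bool := foldFn readStep (fun _ => []) ∘ fanoutFn (fun _ => []) _root_.id

/-- `readVecF ∈ FP`. [folklore] -/
theorem readVecF_mem_FP : readVecF ∈ FP :=
  comp_mem_FP (foldFn_mem_FP readStep_mem_FP (const_mem_FP _) foldGrowth_readStep)
    (fanoutFn_mem_FP (const_mem_FP _) (PolyTimeComputable.id _))

/-- Appending canonical items builds the raw code of the values read. [folklore] -/
theorem foldl_readStep (w : List Bool) (L : List (List Bool)) (acc : List ℤ) :
    L.foldl (fun acc a => readStep (boolPair w (boolPair a acc))) (rawE intE acc) = rawE intE (acc ++ L.map ival) := by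
  induction L generalizing acc with
  | nil => simp
  | cons a L ih =>
    rw [List.foldl_cons, readStep_apply, show rawE intE acc ++ boolPair (dpEnc (ival a)) [] = rawE intE (acc ++ [ival a]) by
      rw [rawE_append]; rfl, ih]
    simp

/-- **`readVec` on codes**: every string is read, in polynomial time, as the raw code of the integer
values of its items. [cite: AroraBarak2009, §1.3] -/
theorem readVec_codeFP : CodeFP strE (rawE intE) readVec := by
  refine of_fn readVecF readVecF_mem_FP fun a => ?_
  simp only [readVecF, Function.comp_apply, fanoutFn_apply, strE, _root_.id]
  rw [foldFn_boolPair, show ([] : List Bool) = rawE intE [] from rfl, foldl_readStep]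
  simp [readVec]

/-! ### The acceptance test and the first accepted answer on codes -/

/-- The code of the test's arguments `(c, (V, z))`. [folklore] -/
abbrev testE : Ctx × (List (List ℤ) × List ℤ) → List Bool := pairE ctxE (pairE matE (rawE intE))

/-- **`verify` on codes.** [cite: MicciancioRegev2007, Lemma 5.10 (the test ‖u − t‖ ≤ ‖S‖/4); AroraBarak2009 §1.3] -/
theorem verify_codeFP : CodeFP testE bitE (fun p => verify p.1 p.2.1 p.2.2) := by
  have hn : CodeFP testE unE (fun p => p.1.n) := (ctx_n_codeFP.comp (fst _ _) :)
  have hU : CodeFP testE matE (fun p => p.1.U) := (ctx_U_codeFP.comp (fst _ _) :)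
  have hV : CodeFP testE matE (fun p => p.2.1) := ((snd _ _).fst' :)
  have hz : CodeFP testE (rawE intE) (fun p => p.2.2) := ((snd _ _).snd' :)
  have hlen : CodeFP testE bitE (fun p => decide (p.2.2.length = p.1.n)) :=
    ((CodeFP.eq unE_injective).comp (((ulength intE).comp hz).pair hn) :)
  have hu : CodeFP testE (rawE intE) (fun p => vecMulZ p.1.n p.2.2 p.1.U) := (vecMulZ_codeFP.comp (hn.pair (hz.pair hU)) :)
  have htd : CodeFP testE natE (fun p => roundTd p.2.1) := (roundTd_codeFP.comp hV :)
  have hsu : CodeFP testE (rawE intE) (fun p => smulZ (roundTd p.2.1 : ℤ) (vecMulZ p.1.n p.2.2 p.1.U)) :=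
    (smulZ_codeFP.comp ((intOfNat.comp htd).pair hu) :)
  have hd : CodeFP testE (rawE intE) (fun p => subZ p.1.n (smulZ (roundTd p.2.1 : ℤ) (vecMulZ p.1.n p.2.2 p.1.U)) (roundTw p.2.1)) :=
    (subZ_codeFP.comp (hn.pair (hsu.pair (roundTw_codeFP.comp hV))) :)
  have hl : CodeFP testE intE (fun p => 16 * sqNormZ (subZ p.1.n (smulZ (roundTd p.2.1 : ℤ)
      (vecMulZ p.1.n p.2.2 p.1.U)) (roundTw p.2.1))) := (intMul.comp ((const _ (16 : ℤ)).pair (sqNormZ_codeFP.comp hd)) :)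
  have hr : CodeFP testE intE (fun p => (roundTd p.2.1 : ℤ) ^ 2 * roundA p.2.1) :=
    (intMul.comp ((intPow.comp ((intOfNat.comp htd).pair (const _ 2))).pair (roundA_codeFP.comp hV)) :)
  have h1 : CodeFP testE bitE (fun p => decide (16 * sqNormZ (subZ p.1.n (smulZ (roundTd p.2.1 : ℤ)
      (vecMulZ p.1.n p.2.2 p.1.U)) (roundTw p.2.1)) ≤ (roundTd p.2.1 : ℤ) ^ 2 * roundA p.2.1)) := (intLe.comp (hl.pair hr) :)
  have h2 : CodeFP testE bitE (fun p => decide (sqNormZ (vecMulZ p.1.n p.2.2 p.1.U) ≤ roundA p.1.U)) :=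
    (intLe.comp ((sqNormZ_codeFP.comp hu).pair (roundA_codeFP.comp hU)) :)
  exact ((hlen.and (h1.and h2)) :)

/-- The code of `(c, V)` with a list of answers. [folklore] -/
abbrev answersE : (Ctx × List (List ℤ)) × List (List Bool) → List Bool := pairE (pairE ctxE matE) (rawE strE)

/-- **`firstAccepted` on codes.** [cite: AroraBarak2009, §1.3] -/
theorem firstAccepted_codeFP : CodeFP answersE (optE (rawE intE)) (fun p => firstAccepted p.1.1 p.1.2 p.2) := by
  -- the test of one answer, context `(c, V)`
  have ht : CodeFP (pairE (pairE ctxE matE) strE) bitE (fun q => verify q.1.1 q.1.2 (readVec q.2)) :=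
    (verify_codeFP.comp ((fst _ _).fst'.pair ((fst _ _).snd'.pair (readVec_codeFP.comp (snd _ _)))) :)
  have hfind := (rawFind? ht :)
  -- the new row from the accepted answer, context `(c, V)`
  have hg : CodeFP (pairE (pairE ctxE matE) strE) (rawE intE) (fun q => vecMulZ q.1.1.n (readVec q.2) q.1.1.U) :=
    (vecMulZ_codeFP.comp ((ctx_n_codeFP.comp (fst _ _).fst').pair ((readVec_codeFP.comp (snd _ _)).pair
      (ctx_U_codeFP.comp (fst _ _).fst'))) :)
  have hmap := (optMap hg :)
  exact ((hmap.comp ((fst _ _).pair hfind)) :)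

/-! ### One round on codes -/

/-- The code of `(c, (state, coin words of the round))`. [folklore] -/
abbrev roundE : Ctx × ((Bool × List (List ℤ)) × List (List Bool)) → List Bool :=
  pairE ctxE (pairE (pairE bitE matE) (rawE strE))

variable {sol : List Bool → List Bool → List Bool}

/-- **One round on codes**, for an answer function computed on codes. [cite: MicciancioRegev2007, Lemma 5.10 (one iteration); AroraBarak2009 §1.3] -/
theorem roundUpdate_codeFP (hsol : CodeFP (pairE strE strE) strE (fun q => sol q.1 q.2)) :
    CodeFP roundE (pairE bitE matE) (fun p => roundUpdate p.1 sol p.2.1 p.2.2) := by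
  have hc : CodeFP roundE ctxE (fun p => p.1) := (fst _ _ :)
  have hrun : CodeFP roundE bitE (fun p => p.2.1.1) := ((snd _ _).fst'.fst' :)
  have hV : CodeFP roundE matE (fun p => p.2.1.2) := ((snd _ _).fst'.snd' :)
  have hcoins : CodeFP roundE (rawE strE) (fun p => p.2.2) := ((snd _ _).snd' :)
  -- the answers: the solver on the padded instance, once per coin word
  have hJ : CodeFP roundE strE (fun p => (roundInst p.1 p.2.1.2).encode) := (roundInst_encode_codeFP.comp (hc.pair hV) :)
  have hans : CodeFP roundE (rawE strE) (fun p => p.2.2.map fun w => sol (roundInst p.1 p.2.1.2).encode w) :=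
    ((CodeFP.map (σ := List Bool) (g := fun q : List Bool × List Bool => sol q.1 q.2) hsol).comp (hJ.pair hcoins) :)
  have hfa : CodeFP roundE (optE (rawE intE)) (fun p => firstAccepted p.1 p.2.1.2
      (p.2.2.map fun w => sol (roundInst p.1 p.2.1.2).encode w)) := (firstAccepted_codeFP.comp ((hc.pair hV).pair hans) :)
  -- the case analysis on the first accepted answer, context `(c, V)`
  have hk := optCases (σ := Ctx × List (List ℤ)) (α := List ℤ) (δ := Bool × List (List ℤ)) (eσ := pairE ctxE matE)
    (eα := rawE intE) (eδ := pairE bitE matE)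
    (k := fun s o => match o with | some u => (true, s.2.set (roundIdx s.2) u) | none => (false, s.2))
    (gnone := fun s => (false, s.2)) (gsome := fun t => (true, t.1.2.set (roundIdx t.1.2) t.2))
    (((const _ false).pair (snd _ _)) :)
    (((const _ true).pair ((setAt (rawE intE)).comp ((fst _ _).snd'.pair ((roundIdx_codeFP.comp (fst _ _).snd').pair
      (snd _ _))))) :)
    (fun _ => rfl) (fun _ _ => rfl)
  have hcase := (hk.comp ((hc.pair hV).pair hfa) :)
  have hst : CodeFP roundE (pairE bitE matE) (fun p => p.2.1) := ((snd _ _).fst' :)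
  exact ((CodeFP.ite hrun hcase hst) :).congr fun p => by
    obtain ⟨c, ⟨run, V⟩, coins⟩ := p
    cases run <;> rfl

/-! ### The state stays polynomially bounded on every input -/

/-- The rows that can occur along a run from `(running, U)`: rows of `U`, or accepted rows (length `n`,
squared norm clamped by `‖U‖²`). [folklore] -/
def RowOK (c : Ctx) (r : List ℤ) : Prop := r ∈ c.U ∨ (r.length = c.n ∧ sqNormZ r ≤ roundA c.U)

/-- States along a run: as many rows as `U`, each `RowOK`. [folklore] -/
def StateOK (c : Ctx) (st : Bool × List (List ℤ)) : Prop := st.2.length = c.U.length ∧ ∀ r ∈ st.2, RowOK c r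

/-- The start is OK. [folklore] -/
theorem stateOK_start (c : Ctx) : StateOK c (true, c.U) := ⟨rfl, fun _ hr => Or.inl hr⟩

/-- Good rows (the analysis' invariant) are OK (the machine's invariant). [folklore] -/
theorem stateOK_of_goodRows {c : Ctx} (hc : c.WF) {V : List (List ℤ)} (hV : GoodRows c V) (b : Bool) :
    StateOK c (b, V) :=
  ⟨by rw [hV.len, hc.len_U], fun r hr => Or.inr ⟨hV.row r hr, hV.bound r hr⟩⟩

/-- **One round keeps the state OK**, whatever the oracle answers (the clamp in `verify`). [folklore] -/
theorem stateOK_roundUpdate (c : Ctx) (sol : List Bool → List Bool → List Bool) {st : Bool × List (List ℤ)}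
    (h : StateOK c st) (coins : List (List Bool)) : StateOK c (roundUpdate c sol st coins) := by
  obtain ⟨run, V⟩ := st
  unfold roundUpdate
  cases run
  · simpa using h
  · simp only [ite_true]
    cases hf : firstAccepted c V (coins.map (sol (roundInst c V).encode)) with
    | none => exact h
    | some u =>
      obtain ⟨a, -, hv, rfl⟩ := firstAccepted_eq_some hf
      obtain ⟨hzlen, -, hclamp⟩ := norm_sub_le_of_verify c V hv
      refine ⟨by rw [List.length_set]; exact h.1, fun r hr => ?_⟩
      rcases List.mem_or_eq_of_mem_set hr with hr | rfl
      · exact h.2 r hr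
      · exact Or.inr ⟨length_vecMulZ _ _ _, hclamp⟩

/-- **Every state of a run is OK.** [folklore] -/
theorem stateOK_foldl (c : Ctx) (sol : List Bool → List Bool → List Bool) (l : List (List (List Bool)))
    {st : Bool × List (List ℤ)} (h : StateOK c st) : StateOK c (l.foldl (roundUpdate c sol) st) := by
  induction l generalizing st with
  | nil => exact h
  | cons b l ih => exact ih (stateOK_roundUpdate c sol h b)

/-- `‖U‖² ≤ |matE U| · 4^{|matE U|}`: entries of a coded matrix are `≤ 2^{|code|}`. [folklore] -/
theorem roundA_le_code (U : List (List ℤ)) : roundA U ≤ (matE U).length * 4 ^ (matE U).length := by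
  by_cases hU : U = []
  · subst hU; simp [roundA, sqNorms]
  obtain ⟨h1, h2, -⟩ := roundIdx_spec hU
  rw [h2, List.getD_eq_getElem _ _ h1]
  set r := U[roundIdx U] with hr
  have hmem : r ∈ U := List.getElem_mem h1
  have hent : ∀ x ∈ r, x.natAbs ≤ 2 ^ (matE U).length := by
    intro x hx
    obtain ⟨j, hj, rfl⟩ := List.getElem_of_mem hx
    have h := entryBound_of_code U (roundIdx U) j
    rwa [ent, List.getD_eq_getElem _ _ h1, ← hr, List.getD_eq_getElem _ _ hj] at h
  have hsq : sqNormZ r ≤ r.length * 4 ^ (matE U).length := by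
    rw [sqNormZ, dotZ_eq_sum r r le_rfl le_rfl]
    calc ∑ t : Fin r.length, r.getD t 0 * r.getD t 0 ≤ ∑ _t : Fin r.length, (4 : ℤ) ^ (matE U).length := by
          refine Finset.sum_le_sum fun t _ => ?_
          rw [List.getD_eq_getElem _ _ t.isLt]
          have h := hent _ (List.getElem_mem t.isLt)
          have habs : (r[(t : ℕ)]).natAbs * (r[(t : ℕ)]).natAbs ≤ 2 ^ (matE U).length * 2 ^ (matE U).length :=
            Nat.mul_le_mul h h
          have : (r[(t : ℕ)] * r[(t : ℕ)] : ℤ) = ((r[(t : ℕ)]).natAbs * (r[(t : ℕ)]).natAbs : ℕ) :=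
            Int.natAbs_mul_self.symm
          rw [this, show (4 : ℤ) ^ (matE U).length = ((2 ^ (matE U).length * 2 ^ (matE U).length : ℕ) : ℤ) by
            push_cast; rw [← mul_pow]; norm_num]
          exact_mod_cast habs
      _ = r.length * 4 ^ (matE U).length := by simp
  have hlen : r.length ≤ (matE U).length := by
    have h1 := length_le_length_rawE intE r
    have h2 := length_item_le_length_rawE (rawE intE) hmem
    change r.length ≤ (rawE (rawE intE) U).length
    omega
  calc sqNormZ r ≤ r.length * 4 ^ (matE U).length := hsq
    _ ≤ (matE U).length * 4 ^ (matE U).length := by gcongr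

/-- A single coordinate is bounded by the squared norm. [folklore] -/
theorem natAbs_le_sqNormZ {r : List ℤ} {x : ℤ} (hx : x ∈ r) : (x.natAbs : ℤ) ≤ sqNormZ r := by
  obtain ⟨j, hj, rfl⟩ := List.getElem_of_mem hx
  rw [sqNormZ, dotZ_eq_sum r r le_rfl le_rfl]
  calc ((r[j]).natAbs : ℤ) ≤ r[j] * r[j] := by
        rcases le_or_gt 0 r[j] with h | h
        · rw [Int.natAbs_of_nonneg h]; nlinarith [Int.emod_emod_of_dvd r[j] (dvd_refl (1:ℤ))]
        · rw [Int.ofNat_natAbs_of_nonpos h.le]; nlinarith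
    _ = r.getD j 0 * r.getD j 0 := by rw [List.getD_eq_getElem _ _ hj]
    _ ≤ ∑ t : Fin r.length, r.getD t 0 * r.getD t 0 :=
        Finset.single_le_sum (f := fun t : Fin r.length => r.getD t 0 * r.getD t 0)
          (fun t _ => mul_self_nonneg _) (Finset.mem_univ ⟨j, hj⟩)

/-- The size of the lattice data of a context: `|⟨1ⁿ, U⟩|`. [folklore] -/
def Ctx.size (c : Ctx) : ℕ := (pairE unE matE (c.n, c.U)).length

/-- `|⟨1ⁿ, U⟩| = 2n + 2 + |matE U|`. [folklore] -/
theorem Ctx.size_eq (c : Ctx) : c.size = 2 * c.n + 2 + (matE c.U).length := by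
  simp [Ctx.size, length_unE]

/-- The context code is longer than the lattice data. [folklore] -/
theorem Ctx.size_le_length_ctxE (c : Ctx) : c.size ≤ (ctxE c).length := by
  have : (ctxE c).length = 2 * (2 * c.n + 2 + (matE c.U).length) + 2 + (2 * c.k₀ + 2 + c.P) := by
    simp [ctxE, ctxTup, length_unE]
  rw [Ctx.size_eq, this]; omega

/-- **Rows along a run have short codes**: `|rawE intE r| ≤ 42 |⟨1ⁿ, U⟩|²`. [folklore] -/
theorem length_row_le_of_rowOK {c : Ctx} {r : List ℤ} (h : RowOK c r) :
    (rawE intE r).length ≤ 42 * c.size ^ 2 := by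
  set L := c.size with hL
  set M := (matE c.U).length with hM
  have hctx : L = 2 * c.n + 2 + M := by rw [hL, Ctx.size_eq]
  have hML : M ≤ L := by omega
  have hnL : c.n ≤ L := by omega
  have hL1 : 1 ≤ L := by omega
  rcases h with h | ⟨hlen, hclamp⟩
  · have := length_item_le_length_rawE (rawE intE) h
    change 2 * (rawE intE r).length + 2 ≤ M at this
    nlinarith
  · -- each entry: `|x| ≤ ‖U‖² ≤ M 4^M`, so its code has `≤ 3(4M+1) + 2` bits … generously `≤ 15M + 5`
    have hA := roundA_le_code c.U
    have hent : ∀ x ∈ r, (intE x).length ≤ 15 * M + 5 := by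
      intro x hx
      have h1 : (x.natAbs : ℤ) ≤ M * 4 ^ M := (natAbs_le_sqNormZ hx).trans (hclamp.trans hA)
      have h1' : x.natAbs ≤ M * 4 ^ M := by exact_mod_cast h1
      have h2 : Nat.size x.natAbs ≤ Nat.size M + (M * Nat.size 4 + 1) :=
        (size_mono h1').trans ((size_mul_le _ _).trans (Nat.add_le_add_left (size_pow_le _ _) _))
      have h3 : Nat.size M ≤ M := Nat.size_le.2 (Nat.lt_two_pow_self)
      have h4 : Nat.size 4 = 3 := by decide
      rw [h4] at h2
      have := length_dpEnc_le x
      change (dpEnc x).length ≤ _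
      omega
    have h := length_rawE_le_mul intE hent
    rw [hlen] at h
    calc (rawE intE r).length ≤ c.n * (2 * (15 * M + 5) + 2) := h
      _ ≤ L * (2 * (15 * L + 5) + 2) := by gcongr
      _ ≤ 42 * L ^ 2 := by nlinarith

/-- **States along a run have short codes**: `|matE V| ≤ 86 |⟨1ⁿ, U⟩|³`. [folklore] -/
theorem length_matE_le_of_stateOK {c : Ctx} {st : Bool × List (List ℤ)} (h : StateOK c st) :
    (matE st.2).length ≤ 86 * c.size ^ 3 := by
  set L := c.size with hL
  have hctx : L = 2 * c.n + 2 + (matE c.U).length := by rw [hL, Ctx.size_eq]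
  have hUL : c.U.length ≤ L := (length_le_length_rawE (rawE intE) c.U).trans (by change (matE c.U).length ≤ L; omega)
  have hrows := length_rawE_le_mul (rawE intE) (l := st.2) (E := 42 * L ^ 2) fun r hr => length_row_le_of_rowOK (h.2 r hr)
  rw [h.1] at hrows
  have : (matE st.2).length ≤ L * (2 * (42 * L ^ 2) + 2) := hrows.trans (by gcongr)
  nlinarith

/-- **States along a run have short codes**: `|code (running?, V)| ≤ 86 |ctxE c|³ + 4`. [folklore] -/
theorem length_state_le_of_stateOK {c : Ctx} {st : Bool × List (List ℤ)} (h : StateOK c st) :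
    (pairE bitE matE st).length ≤ 86 * (ctxE c).length ^ 3 + 4 := by
  have h1 := length_matE_le_of_stateOK h
  have h2 := Nat.pow_le_pow_left (Ctx.size_le_length_ctxE c) 3
  rw [pairE_apply, length_boolPair]
  have hb : (bitE st.1).length = 1 := rfl
  rw [hb]
  nlinarith

/-- **The unpadded instances met along a run are polynomially short in the lattice data**: for SOME
polynomial `P₀`, `|code (roundInst₀ c V)| ≤ P₀(|⟨1ⁿ, U⟩|)` for every state `V` of a run (so the padding
length `P` can be chosen as a polynomial of the input, independently of `k₀` and of `P` itself). [folklore] -/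
theorem exists_poly_length_roundInst₀ : ∃ P₀ : Polynomial ℕ, ∀ (c : Ctx) (st : Bool × List (List ℤ)),
    StateOK c st → (roundInst₀ c st.2).encode.length ≤ P₀.eval c.size := by
  -- the instance as a function of `((n, U), V)` alone
  have h : CodeFP (pairE (pairE unE matE) matE) strE (fun p => (roundInst₀ ⟨p.1.1, p.1.2, 0, 0⟩ p.2).encode) := by
    have hctx : CodeFP (pairE (pairE unE matE) matE) ctxE (fun p => (⟨p.1.1, p.1.2, 0, 0⟩ : Ctx)) :=
      (((fst _ _).pair ((const _ 0).pair (const _ 0))).recodeOut fun p => rfl :)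
    exact (roundInst₀_encode_codeFP.comp (hctx.pair (snd _ _)) :)
  obtain ⟨f, hf, hfg⟩ := h
  obtain ⟨P₁, hP₁⟩ := exists_poly_length_le_of_mem_FP hf
  refine ⟨P₁.comp (2 * X + 2 + 86 * X ^ 3), fun c st hst => ?_⟩
  have h1 : (roundInst₀ c st.2).encode = f (pairE (pairE unE matE) matE ((c.n, c.U), st.2)) := by
    rw [hfg]; rfl
  rw [h1, eval_comp]
  refine (hP₁ _).trans (TM2Iter.eval_mono P₁ ?_)
  have h2 := length_matE_le_of_stateOK hst
  have h3 := Ctx.size_eq c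
  simp only [eval_add, eval_mul, eval_pow, eval_X, eval_ofNat, pairE_apply, length_boolPair, length_unE] at h3 ⊢
  omega

/-! ### The loop on codes -/

/-- The code of the loop's input `((c, (K, T)), coins)`. [folklore] -/
abbrev loopInE : (Ctx × (ℕ × ℕ)) × List Bool → List Bool := pairE (pairE ctxE (pairE unE unE)) strE

/-- **The coin blocks on codes** (two nested `strChunks`). [cite: AroraBarak2009, §1.3] -/
theorem blocksOf_codeFP : CodeFP loopInE (rawE (rawE strE)) (fun p => blocksOf p.1.2.1 p.1.1.k₀ p.1.2.2 p.2) := by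
  have hK : CodeFP loopInE unE (fun p => p.1.2.1) := ((fst _ _).snd'.fst' :)
  have hT : CodeFP loopInE unE (fun p => p.1.2.2) := ((fst _ _).snd'.snd' :)
  have hk : CodeFP loopInE unE (fun p => p.1.1.k₀) := (ctx_k₀_codeFP.comp (fst _ _).fst' :)
  have hr : CodeFP loopInE strE (fun p => p.2) := (snd _ _ :)
  -- unary multiplication (cf. `QuantumComplexity.unMul_codeFP`)
  have unMul : CodeFP (pairE unE unE) unE (fun p => p.1 * p.2) :=
    ((ulength unitE).comp (unitsMul.comp ((replicateUnit.comp (fst _ _)).pair (replicateUnit.comp (snd _ _))))).congr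
      fun p => by simp
  -- the big chunks of width `K k₀`
  have hbig : CodeFP loopInE (rawE strE) (fun p => (List.range p.1.2.2).map fun j =>
      (p.2.drop (j * (p.1.2.1 * p.1.1.k₀))).take (p.1.2.1 * p.1.1.k₀)) :=
    (strChunks.comp (hT.pair ((unMul.comp (hK.pair hk)).pair hr)) :)
  -- each cut into `k₀` words of width `K`, context `(k₀, K)`
  have hitem : CodeFP (pairE (pairE unE unE) strE) (rawE strE)
      (fun q => (List.range q.1.1).map fun l => (q.2.drop (l * q.1.2)).take q.1.2) :=
    (strChunks.comp ((fst _ _).fst'.pair ((fst _ _).snd'.pair (snd _ _))) :)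
  have h := ((CodeFP.map hitem).comp ((hk.pair hK).pair hbig) :)
  refine h.congr fun p => ?_
  simp only [blocksOf, Literature.Computability.Cryptography.chunk, List.map_map, Function.comp_def]
  refine List.map_congr_left fun j _ => List.map_congr_left fun l _ => ?_
  rw [Nat.mul_comm j, Nat.mul_comm l]

/-- **The loop on codes** (a left fold of the round over the blocks, with the state bounded by
`86|ctxE c|³ + 4` on every input). [cite: MicciancioRegev2007, Lemma 5.10 (the reduction); AroraBarak2009 §1.3 (bounded loops)] -/
theorem loopOut_codeFP (hsol : CodeFP (pairE strE strE) strE (fun q => sol q.1 q.2)) :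
    CodeFP loopInE (pairE bitE matE) (fun p => loopOut p.1.1 sol p.1.2.1 p.1.2.2 p.2) := by
  have hstep : CodeFP (pairE ctxE (pairE (rawE strE) (pairE bitE matE))) (pairE bitE matE)
      (fun t => roundUpdate t.1 sol t.2.2 t.2.1) :=
    ((roundUpdate_codeFP hsol).comp ((fst _ _).pair ((snd _ _).snd'.pair (snd _ _).fst')) :)
  have hinit : CodeFP ctxE (pairE bitE matE) (fun c => (true, c.U)) := ((const _ true).pair ctx_U_codeFP :)
  have hfold := CodeFP.foldl (σ := Ctx) (α := List (List Bool)) (β := Bool × List (List ℤ)) (eσ := ctxE)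
    (eα := rawE strE) (eβ := pairE bitE matE) (step := fun c b st => roundUpdate c sol st b) (init := fun c => (true, c.U))
    hstep hinit (86 * X ^ 3 + 4) (fun c l₁ l₂ => by
      have h := length_state_le_of_stateOK (stateOK_foldl c sol l₁ (stateOK_start c))
      refine h.trans ?_
      simp only [eval_add, eval_mul, eval_pow, eval_X, eval_ofNat, pairE_apply, length_boolPair]
      have : (ctxE c).length ≤ 2 * (ctxE c).length + 2 + (rawE (rawE strE) (l₁ ++ l₂)).length := by omega
      have := Nat.pow_le_pow_left this 3
      omega)
  exact ((hfold.comp ((fst _ _).fst'.pair blocksOf_codeFP)) :)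

end MRLemma510

end Literature.Algebra.EuclideanLattices

end
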